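/-
Copyright (c) 2026 the pub-hodgecm-mathlib formalisation cell (harness21).  Prover seat hodgecm-mathlib-F0P3a-p02 (g23): N8-INNER brick (8) «one-place wall EP generator»,
the form-level CORE of the spectral-signature vanishing lemma (LH2-plan (g1) RE-DEAL 17:02:37Z; LHref-N (g4) BOXES #44∕#45), 2026-09-02.
-/
import Literature.NumberTheory.Automorphic.UnitaryGroupAutomorphicRep     -- ★ `unitaryGroupOfForm`, `mem_unitaryGroupOfForm_iff`
import Mathlib.Topology.Maps.Proper.Basic
import Mathlib.Analysis.Normed.Module.FiniteDimension
import Mathlib.LinearAlgebra.Matrix.ConjTranspose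
import HarnessLib

/-!
# Eigenline windows of a hermitian form: the spectral-signature obstruction to conjugacy (Sylvester's law of inertia, open form) — form-level core
# (Shelstad 1979 §4; Rogawski 1990 §8.2, §12.2; Bouaziz 1994 §2.2)

Topic `NumberTheory/Automorphic`; namespace `Literature.NumberTheory.Automorphic.UnitaryGroup`.  THEOREMS ONLY (no definition, no instance, no notation, no named fact, no `sorry`);
kernel lane `--supports stmt-HodgeConjecture-24833`.  Cell `pub/hodgecm-mathlib`, crux H413 (`stmt-HodgeConjecture-24833`), road «N8-INNER» (LEAD T14-4), brick (8) «one-place wall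
EP generator» (binder LH1-p01 (g12)): the lemma both designs of (8e) need (LHref-N (g4) BOX #45: «the support∕spectral-signature vanishing lemma»), dealt to this seat by LH2-plan (g1)
17:02:37Z.  Count-neutral.

THE MATHEMATICS.  `J` a form on `ℂⁿ`, `U(J) = {g : ᵗḡ J g = J}`; window `{λ : |λ − u| ≤ ρ}`; `Good(J,u,ρ) := {x : every eigenvector ξ of x with eigenvalue in the window and
Re J(ξ,ξ) ≤ 0 is zero}`.  (1) `Good` is OPEN (its complement is the projection of a closed incidence set along the COMPACT `sphere × closed disc`); (2) `Good` is
`U(J)`-conjugation invariant; (3) `diag(d) ∈ Good(diag(a),u,ρ)` when every window slot has `a k > 0` (the COMPACT-WALL representative `diag(u,u,v)`, repeated `u` on a definite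
plane, `|v − u| > ρ`); (4) `∉` when a window slot has `a k ≤ 0`; (5) `∉` when `x` has an ISOTROPIC window eigenvector (split tori: `|λ| ≠ 1` forces `J(ξ,ξ) = 0` for
`x ∈ U(J)`).  The one-place docking (the head brick (8e′) consumes, `exists_nhds_forall_conj_gprimeBlockAt_not_mem`) is ★ `ArchSpectralSignatureVanishing` over this file.
* `isClosed_setOf_exists_eigenvector_re_le_zero`, **`isOpen_setOf_forall_eigenvector_re_pos`** (1); `star_mulVec_dotProduct_mulVec_of_mem`,
  **`conj_mem_setOf_forall_eigenvector_iff`**, `forall_conj_not_mem_of_not_mem` (2); **`diagonal_mem_setOf_forall_eigenvector`** (3), `diagonal_not_mem_setOf_forall_eigenvector`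
  (4); `star_dotProduct_mulVec_eq_zero_of_norm_ne_one`, `not_mem_setOf_forall_eigenvector_of_isotropic` (5); `mem_unitaryGroupOfForm_smul`.
HONEST LABEL: HC_CM is proved only modulo the 7 printed citations (2 remaining: hLiu418 = `stmt-HodgeConjecture-24832`, h413 = `stmt-HodgeConjecture-24833`) until rung 0 closes;
linear algebra + point-set topology over Mathlib, pays nothing by itself.

## References
* [Shelstad1979] D. Shelstad, *Characters and inner forms of a quasi-split group over ℝ*, Compositio Math. 39 (1979), §4 pp. 22–25 (Cartan subgroups of `U(p,q)` up to
  conjugacy: the signature carried by the eigen-planes).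
* [Rogawski1990] J. D. Rogawski, *Automorphic Representations of Unitary Groups in Three Variables*, Ann. of Math. Stud. 123 (1990), §8.2 p. 119, §12.2 p. 172
  (elliptic elements of `U(2,1)` and their compact∕non-compact neighbours).
* [Bouaziz1994IntegralesOrbitales] A. Bouaziz, *Intégrales orbitales sur les groupes de Lie réductifs*, Ann. Sci. ÉNS 27 (1994), §2.2 (invariant neighbourhoods of
  semisimple elements).
-/

set_option autoImplicit false

noncomputable section

open Set Filter Topology Function Matrix Complex

namespace Literature.NumberTheory.Automorphic

namespace UnitaryGroup

variable {n : ℕ}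

/-! ## §1 Openness: «no non-positive eigenline in the eigenvalue window» is an open condition -/

/-- The matrices with a UNIT eigenvector of non-positive `J`-length and eigenvalue in `{|λ − u| ≤ ρ}` form a CLOSED set (projection of a closed incidence set along the
compact `sphere × closed disc`). [cite: Bouaziz1994IntegralesOrbitales, §2.2] -/
theorem isClosed_setOf_exists_eigenvector_re_le_zero (J : Matrix (Fin n) (Fin n) ℂ) (u : ℂ) (ρ : ℝ) :
    IsClosed {x : Matrix (Fin n) (Fin n) ℂ | ∃ ξ : Fin n → ℂ, ‖ξ‖ = 1 ∧ ∃ μ : ℂ, ‖μ - u‖ ≤ ρ ∧ x *ᵥ ξ = μ • ξ ∧ (star ξ ⬝ᵥ J *ᵥ ξ).re ≤ 0} := by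
  -- the compact parameter space `K = sphere × closed disc`
  set K : Set ((Fin n → ℂ) × ℂ) := Metric.sphere (0 : Fin n → ℂ) 1 ×ˢ Metric.closedBall u ρ with hK
  have hKc : IsCompact K := (isCompact_sphere _ _).prod (isCompact_closedBall _ _)
  haveI : CompactSpace K := isCompact_iff_compactSpace.1 hKc
  -- the closed incidence set in `M × K`
  set C : Set (Matrix (Fin n) (Fin n) ℂ × K) :=
    {p | p.1 *ᵥ (p.2 : (Fin n → ℂ) × ℂ).1 = (p.2 : (Fin n → ℂ) × ℂ).2 • (p.2 : (Fin n → ℂ) × ℂ).1 ∧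
      (star (p.2 : (Fin n → ℂ) × ℂ).1 ⬝ᵥ J *ᵥ (p.2 : (Fin n → ℂ) × ℂ).1).re ≤ 0} with hC
  have hCc : IsClosed C := by
    have h1 : Continuous fun p : Matrix (Fin n) (Fin n) ℂ × K => p.1 *ᵥ (p.2 : (Fin n → ℂ) × ℂ).1 :=
      Continuous.matrix_mulVec continuous_fst (continuous_fst.comp (continuous_subtype_val.comp continuous_snd))
    have h2 : Continuous fun p : Matrix (Fin n) (Fin n) ℂ × K => (p.2 : (Fin n → ℂ) × ℂ).2 • (p.2 : (Fin n → ℂ) × ℂ).1 :=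
      (continuous_snd.comp (continuous_subtype_val.comp continuous_snd)).smul (continuous_fst.comp (continuous_subtype_val.comp continuous_snd))
    have h3 : Continuous fun p : Matrix (Fin n) (Fin n) ℂ × K => (star (p.2 : (Fin n → ℂ) × ℂ).1 ⬝ᵥ J *ᵥ (p.2 : (Fin n → ℂ) × ℂ).1).re := by
      have hv : Continuous fun p : Matrix (Fin n) (Fin n) ℂ × K => (p.2 : (Fin n → ℂ) × ℂ).1 :=
        continuous_fst.comp (continuous_subtype_val.comp continuous_snd)
      exact Complex.continuous_re.comp ((hv.star).dotProduct (continuous_const.matrix_mulVec hv))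
    exact (isClosed_eq h1 h2).inter (isClosed_le h3 continuous_const)
  -- the bad set is the projection of `C`
  have himage : {x : Matrix (Fin n) (Fin n) ℂ | ∃ ξ : Fin n → ℂ, ‖ξ‖ = 1 ∧ ∃ μ : ℂ, ‖μ - u‖ ≤ ρ ∧ x *ᵥ ξ = μ • ξ ∧ (star ξ ⬝ᵥ J *ᵥ ξ).re ≤ 0} =
      Prod.fst '' C := by
    ext x
    simp only [mem_setOf_eq, mem_image, Prod.exists, hC]
    constructor
    · rintro ⟨ξ, hξ, μ, hμ, hx, hq⟩
      have hk : (ξ, μ) ∈ K := by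
        rw [hK]; exact ⟨by simpa [Metric.mem_sphere, dist_zero_right] using hξ, by simpa [Metric.mem_closedBall, dist_eq_norm] using hμ⟩
      exact ⟨x, ⟨(ξ, μ), hk⟩, ⟨hx, hq⟩, rfl⟩
    · rintro ⟨x', k, ⟨hx, hq⟩, rfl⟩
      obtain ⟨⟨ξ, μ⟩, hk⟩ := k
      rw [hK] at hk
      obtain ⟨hξ, hμ⟩ := hk
      refine ⟨ξ, by simpa [Metric.mem_sphere, dist_zero_right] using hξ, μ, by simpa [Metric.mem_closedBall, dist_eq_norm] using hμ, hx, hq⟩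
  rw [himage]
  exact isClosedMap_fst_of_compactSpace C hCc

/-- **OPENNESS.**  `Good(J,u,ρ) := {x : every eigenvector ξ of x with eigenvalue in {|λ − u| ≤ ρ} and Re J(ξ,ξ) ≤ 0 is zero}` is OPEN in `Mₙ(ℂ)`.
[cite: Bouaziz1994IntegralesOrbitales, §2.2] [cite: Shelstad1979, §4 p. 23] -/
theorem isOpen_setOf_forall_eigenvector_re_pos (J : Matrix (Fin n) (Fin n) ℂ) (u : ℂ) (ρ : ℝ) :
    IsOpen {x : Matrix (Fin n) (Fin n) ℂ | ∀ (ξ : Fin n → ℂ) (μ : ℂ), x *ᵥ ξ = μ • ξ → ‖μ - u‖ ≤ ρ → (star ξ ⬝ᵥ J *ᵥ ξ).re ≤ 0 → ξ = 0} := by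
  have h := (isClosed_setOf_exists_eigenvector_re_le_zero J u ρ).isOpen_compl
  convert h using 1
  ext x
  simp only [mem_setOf_eq, mem_compl_iff, not_exists, not_and]
  constructor
  · intro hx ξ hξ μ hμ hx' hq
    have := hx ξ μ hx' hμ hq
    rw [this, norm_zero] at hξ
    exact zero_ne_one hξ
  · intro hx ξ μ hx' hμ hq
    by_contra h0
    have hn : ‖ξ‖ ≠ 0 := norm_ne_zero_iff.2 h0
    have hnpos : 0 < ‖ξ‖ := norm_pos_iff.2 h0
    -- normalise the eigenvector
    set η : Fin n → ℂ := ((‖ξ‖⁻¹ : ℝ) : ℂ) • ξ with hη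
    have hη1 : ‖η‖ = 1 := by
      rw [hη, norm_smul, Complex.norm_real, norm_inv, norm_norm, inv_mul_cancel₀ hn]
    have hηe : x *ᵥ η = μ • η := by rw [hη, mulVec_smul, hx', smul_comm]
    have hηq : (star η ⬝ᵥ J *ᵥ η).re ≤ 0 := by
      rw [hη, star_smul, mulVec_smul, smul_dotProduct, dotProduct_smul, Complex.star_def, Complex.conj_ofReal, smul_eq_mul, smul_eq_mul, ← mul_assoc,
        ← Complex.ofReal_mul, Complex.re_ofReal_mul]
      exact mul_nonpos_of_nonneg_of_nonpos (mul_self_nonneg _) hq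
    exact hx η hη1 μ hμ hηe hηq

/-! ## §2 Conjugation invariance under `U(J)` -/

/-- An isometry `g ∈ U(J)` preserves `J`-lengths: `J(gξ, gξ) = J(ξ, ξ)`. [cite: Shelstad1979, §4 p. 22] -/
theorem star_mulVec_dotProduct_mulVec_of_mem {J : Matrix (Fin n) (Fin n) ℂ} {g : GL (Fin n) ℂ}
    (hg : g ∈ unitaryGroupOfForm (starRingEnd ℂ) J) (ξ : Fin n → ℂ) :
    star ((g : Matrix (Fin n) (Fin n) ℂ) *ᵥ ξ) ⬝ᵥ J *ᵥ ((g : Matrix (Fin n) (Fin n) ℂ) *ᵥ ξ) = star ξ ⬝ᵥ J *ᵥ ξ := by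
  have hg' : ((g : Matrix (Fin n) (Fin n) ℂ).map (starRingEnd ℂ))ᵀ * J * (g : Matrix (Fin n) (Fin n) ℂ) = J := mem_unitaryGroupOfForm_iff.1 hg
  have hct : ((g : Matrix (Fin n) (Fin n) ℂ).map (starRingEnd ℂ))ᵀ = (g : Matrix (Fin n) (Fin n) ℂ)ᴴ := rfl
  rw [hct] at hg'
  calc star ((g : Matrix (Fin n) (Fin n) ℂ) *ᵥ ξ) ⬝ᵥ J *ᵥ ((g : Matrix (Fin n) (Fin n) ℂ) *ᵥ ξ)
      = (star ξ ᵥ* (g : Matrix (Fin n) (Fin n) ℂ)ᴴ) ⬝ᵥ J *ᵥ ((g : Matrix (Fin n) (Fin n) ℂ) *ᵥ ξ) := by rw [star_mulVec]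
    _ = star ξ ⬝ᵥ ((g : Matrix (Fin n) (Fin n) ℂ)ᴴ * J * (g : Matrix (Fin n) (Fin n) ℂ)) *ᵥ ξ := by
        rw [← dotProduct_mulVec, ← mulVec_mulVec, ← mulVec_mulVec]
    _ = star ξ ⬝ᵥ J *ᵥ ξ := by rw [hg']

/-- **CONJUGATION INVARIANCE.**  For `g ∈ U(J)`, `g x g⁻¹ ∈ Good(J,u,ρ) ↔ x ∈ Good(J,u,ρ)`: an isometry carries an eigenline of `x` to an eigenline of `g x g⁻¹` with the same
eigenvalue and the same `J`-length. [cite: Shelstad1979, §4 pp. 22–23] [cite: Rogawski1990, §12.2 p. 172] -/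
theorem conj_mem_setOf_forall_eigenvector_iff (J : Matrix (Fin n) (Fin n) ℂ) (u : ℂ) (ρ : ℝ) {g : GL (Fin n) ℂ}
    (hg : g ∈ unitaryGroupOfForm (starRingEnd ℂ) J) (x : Matrix (Fin n) (Fin n) ℂ) :
    (g : Matrix (Fin n) (Fin n) ℂ) * x * ((g⁻¹ : GL (Fin n) ℂ) : Matrix (Fin n) (Fin n) ℂ) ∈
        {x : Matrix (Fin n) (Fin n) ℂ | ∀ (ξ : Fin n → ℂ) (μ : ℂ), x *ᵥ ξ = μ • ξ → ‖μ - u‖ ≤ ρ → (star ξ ⬝ᵥ J *ᵥ ξ).re ≤ 0 → ξ = 0} ↔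
      x ∈ {x : Matrix (Fin n) (Fin n) ℂ | ∀ (ξ : Fin n → ℂ) (μ : ℂ), x *ᵥ ξ = μ • ξ → ‖μ - u‖ ≤ ρ → (star ξ ⬝ᵥ J *ᵥ ξ).re ≤ 0 → ξ = 0} := by
  have hgg : ((g⁻¹ : GL (Fin n) ℂ) : Matrix (Fin n) (Fin n) ℂ) * (g : Matrix (Fin n) (Fin n) ℂ) = 1 := by
    rw [← Units.val_mul, inv_mul_cancel, Units.val_one]
  have hgg' : (g : Matrix (Fin n) (Fin n) ℂ) * ((g⁻¹ : GL (Fin n) ℂ) : Matrix (Fin n) (Fin n) ℂ) = 1 := by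
    rw [← Units.val_mul, mul_inv_cancel, Units.val_one]
  have hginv : g⁻¹ ∈ unitaryGroupOfForm (starRingEnd ℂ) J := inv_mem hg
  simp only [mem_setOf_eq]
  constructor
  · -- `x ξ = μ ξ` ⇒ `(g x g⁻¹)(g ξ) = μ (g ξ)`
    intro h ξ μ hx hμ hq
    have h1 : ((g : Matrix (Fin n) (Fin n) ℂ) * x * ((g⁻¹ : GL (Fin n) ℂ) : Matrix (Fin n) (Fin n) ℂ)) *ᵥ ((g : Matrix (Fin n) (Fin n) ℂ) *ᵥ ξ) =
        μ • ((g : Matrix (Fin n) (Fin n) ℂ) *ᵥ ξ) := by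
      rw [mulVec_mulVec, Matrix.mul_assoc, hgg, Matrix.mul_one, ← mulVec_mulVec, hx, mulVec_smul]
    have h2 : (star ((g : Matrix (Fin n) (Fin n) ℂ) *ᵥ ξ) ⬝ᵥ J *ᵥ ((g : Matrix (Fin n) (Fin n) ℂ) *ᵥ ξ)).re ≤ 0 := by
      rw [star_mulVec_dotProduct_mulVec_of_mem hg]; exact hq
    have h3 := h _ μ h1 hμ h2
    have : ((g⁻¹ : GL (Fin n) ℂ) : Matrix (Fin n) (Fin n) ℂ) *ᵥ ((g : Matrix (Fin n) (Fin n) ℂ) *ᵥ ξ) = ξ := by rw [mulVec_mulVec, hgg, one_mulVec]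
    rw [← this, h3, mulVec_zero]
  · intro h ξ μ hx hμ hq
    -- `η := g⁻¹ ξ` is an eigenvector of `x`
    have h1 : x *ᵥ (((g⁻¹ : GL (Fin n) ℂ) : Matrix (Fin n) (Fin n) ℂ) *ᵥ ξ) = μ • (((g⁻¹ : GL (Fin n) ℂ) : Matrix (Fin n) (Fin n) ℂ) *ᵥ ξ) := by
      have h0 := congrArg (fun v => ((g⁻¹ : GL (Fin n) ℂ) : Matrix (Fin n) (Fin n) ℂ) *ᵥ v) hx
      simp only [mulVec_mulVec, ← Matrix.mul_assoc, hgg, Matrix.one_mul, mulVec_smul] at h0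
      rw [← mulVec_mulVec] at h0
      exact h0
    have h2 : (star (((g⁻¹ : GL (Fin n) ℂ) : Matrix (Fin n) (Fin n) ℂ) *ᵥ ξ) ⬝ᵥ J *ᵥ (((g⁻¹ : GL (Fin n) ℂ) : Matrix (Fin n) (Fin n) ℂ) *ᵥ ξ)).re ≤ 0 := by
      rw [star_mulVec_dotProduct_mulVec_of_mem hginv]; exact hq
    have h3 := h _ μ h1 hμ h2
    have : (g : Matrix (Fin n) (Fin n) ℂ) *ᵥ (((g⁻¹ : GL (Fin n) ℂ) : Matrix (Fin n) (Fin n) ℂ) *ᵥ ξ) = ξ := by rw [mulVec_mulVec, hgg', one_mulVec]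
    rw [← this, h3, mulVec_zero]

/-- **«NO CONJUGATE IN `U₀`».**  If `x ∉ Good(J,u,ρ)` then no `U(J)`-conjugate of `x` lies in `Good(J,u,ρ)`; in particular none lies in any `U₀ ⊆ Good(J,u,ρ)` — the support
argument behind the vanishing of orbital readings of a test function with `tsupport ⊆ U₀`. [cite: Bouaziz1994IntegralesOrbitales, §2.2] -/
theorem forall_conj_not_mem_of_not_mem (J : Matrix (Fin n) (Fin n) ℂ) (u : ℂ) (ρ : ℝ) {x : Matrix (Fin n) (Fin n) ℂ}
    (hx : x ∉ {x : Matrix (Fin n) (Fin n) ℂ | ∀ (ξ : Fin n → ℂ) (μ : ℂ), x *ᵥ ξ = μ • ξ → ‖μ - u‖ ≤ ρ → (star ξ ⬝ᵥ J *ᵥ ξ).re ≤ 0 → ξ = 0})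
    {U₀ : Set (Matrix (Fin n) (Fin n) ℂ)}
    (hU₀ : U₀ ⊆ {x : Matrix (Fin n) (Fin n) ℂ | ∀ (ξ : Fin n → ℂ) (μ : ℂ), x *ᵥ ξ = μ • ξ → ‖μ - u‖ ≤ ρ → (star ξ ⬝ᵥ J *ᵥ ξ).re ≤ 0 → ξ = 0})
    {g : GL (Fin n) ℂ} (hg : g ∈ unitaryGroupOfForm (starRingEnd ℂ) J) :
    (g : Matrix (Fin n) (Fin n) ℂ) * x * ((g⁻¹ : GL (Fin n) ℂ) : Matrix (Fin n) (Fin n) ℂ) ∉ U₀ :=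
  fun h => hx ((conj_mem_setOf_forall_eigenvector_iff J u ρ hg x).1 (hU₀ h))

/-! ## §3 Diagonal forms: which torus elements are in `Good` -/

/-- **THE COMPACT-WALL REPRESENTATIVE IS GOOD.**  For a diagonal real form `J = diag(a)` and a diagonal element `diag(d)`: if every slot whose eigenvalue lies in the window
`{|λ − u| ≤ ρ}` is `J`-POSITIVE (`0 < a k`), then `diag(d) ∈ Good(J,u,ρ)` — e.g. `s = diag(u,u,v)` with the repeated `u` on a definite plane and `|v − u| > ρ`.
[cite: Shelstad1979, §4 p. 23] [cite: Rogawski1990, §12.2 p. 172] -/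
theorem diagonal_mem_setOf_forall_eigenvector (a : Fin n → ℝ) (d : Fin n → ℂ) (u : ℂ) (ρ : ℝ)
    (hpos : ∀ k, ‖d k - u‖ ≤ ρ → 0 < a k) :
    diagonal d ∈ {x : Matrix (Fin n) (Fin n) ℂ | ∀ (ξ : Fin n → ℂ) (μ : ℂ), x *ᵥ ξ = μ • ξ → ‖μ - u‖ ≤ ρ →
      (star ξ ⬝ᵥ (diagonal fun k => (a k : ℂ)) *ᵥ ξ).re ≤ 0 → ξ = 0} := by
  simp only [mem_setOf_eq]
  intro ξ μ hx hμ hq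
  -- coordinates: `(d k − μ) ξ k = 0`
  have hk : ∀ k, ξ k ≠ 0 → d k = μ := by
    intro k hk
    have h := congrFun hx k
    rw [mulVec_diagonal, Pi.smul_apply, smul_eq_mul] at h
    exact mul_right_cancel₀ hk h
  -- the `J`-length is `Σ a k |ξ k|²`, each term `≥ 0`, and `> 0` where `ξ k ≠ 0`
  have hterm : ∀ k, (star (ξ k) * ((a k : ℂ) * ξ k)).re = a k * ‖ξ k‖ ^ 2 := by
    intro k
    rw [← mul_assoc, mul_comm (star (ξ k)), mul_assoc, Complex.star_def, Complex.conj_mul', ← Complex.ofReal_pow, ← Complex.ofReal_mul, Complex.ofReal_re]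
  have hsum : (star ξ ⬝ᵥ (diagonal fun k => (a k : ℂ)) *ᵥ ξ).re = ∑ k, a k * ‖ξ k‖ ^ 2 := by
    rw [dotProduct, Complex.re_sum]
    refine Finset.sum_congr rfl fun k _ => ?_
    rw [Pi.star_apply, mulVec_diagonal]
    exact hterm k
  have hnn : ∀ k, 0 ≤ a k * ‖ξ k‖ ^ 2 := by
    intro k
    by_cases h0 : ξ k = 0
    · rw [h0, norm_zero]; simp
    · have hμk := hk k h0
      exact mul_nonneg (hpos k (by rw [hμk]; exact hμ)).le (sq_nonneg _)
  by_contra hne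
  obtain ⟨k, hk0⟩ : ∃ k, ξ k ≠ 0 := Function.ne_iff.1 hne
  have hposk : 0 < a k * ‖ξ k‖ ^ 2 := mul_pos (hpos k (by rw [hk k hk0]; exact hμ)) (by positivity)
  have : 0 < ∑ k, a k * ‖ξ k‖ ^ 2 := lt_of_lt_of_le hposk (Finset.single_le_sum (fun k _ => hnn k) (Finset.mem_univ k))
  rw [← hsum] at this
  exact absurd hq (not_le.2 this)

/-- **A NEGATIVE EIGENLINE IN THE WINDOW IS BAD**: if some slot `k` has its eigenvalue `d k` in the window and `a k ≤ 0`, then `diag(d) ∉ Good(diag(a),u,ρ)` — the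
representatives of the class `{u,u,v}` with a near-`u` phase on a NEGATIVE line. [cite: Shelstad1979, §4 p. 23] -/
theorem diagonal_not_mem_setOf_forall_eigenvector (a : Fin n → ℝ) (d : Fin n → ℂ) (u : ℂ) (ρ : ℝ) {k : Fin n}
    (hk : ‖d k - u‖ ≤ ρ) (hak : a k ≤ 0) :
    diagonal d ∉ {x : Matrix (Fin n) (Fin n) ℂ | ∀ (ξ : Fin n → ℂ) (μ : ℂ), x *ᵥ ξ = μ • ξ → ‖μ - u‖ ≤ ρ →
      (star ξ ⬝ᵥ (diagonal fun k => (a k : ℂ)) *ᵥ ξ).re ≤ 0 → ξ = 0} := by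
  simp only [mem_setOf_eq, not_forall]
  refine ⟨Pi.single k 1, d k, ?_, hk, ?_, ?_⟩
  · ext j
    rw [mulVec_diagonal, Pi.smul_apply, smul_eq_mul]
    by_cases h : j = k
    · subst h; simp
    · simp [Pi.single_eq_of_ne h]
  · rw [dotProduct]
    have : ∀ j, (star (Pi.single k (1 : ℂ) : Fin n → ℂ)) j * (((diagonal fun k => (a k : ℂ)) *ᵥ (Pi.single k (1 : ℂ) : Fin n → ℂ)) j) =
        if j = k then (a k : ℂ) else 0 := by
      intro j
      rw [mulVec_diagonal]
      by_cases h : j = k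
      · subst h; simp
      · simp [h]
    simp only [this, Finset.sum_ite_eq', Finset.mem_univ, if_true, Complex.ofReal_re]
    exact hak
  · intro h
    have := congrFun h k
    simp at this

/-! ## §4 Isotropic eigenlines (split tori) -/

/-- **AN ISOTROPIC EIGENLINE IN THE WINDOW IS BAD**: if `x` has a non-zero eigenvector `ξ` with `Re J(ξ,ξ) = 0` (the hyperbolic eigenlines of a split-torus element are
`J`-isotropic) and eigenvalue in the window, then `x ∉ Good(J,u,ρ)`. [cite: Shelstad1979, §4 p. 22] [cite: Rogawski1990, §8.2 p. 119] -/
theorem not_mem_setOf_forall_eigenvector_of_isotropic (J : Matrix (Fin n) (Fin n) ℂ) (u : ℂ) (ρ : ℝ) {x : Matrix (Fin n) (Fin n) ℂ} {ξ : Fin n → ℂ} {μ : ℂ}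
    (hξ : ξ ≠ 0) (hx : x *ᵥ ξ = μ • ξ) (hμ : ‖μ - u‖ ≤ ρ) (hiso : (star ξ ⬝ᵥ J *ᵥ ξ).re = 0) :
    x ∉ {x : Matrix (Fin n) (Fin n) ℂ | ∀ (ξ : Fin n → ℂ) (μ : ℂ), x *ᵥ ξ = μ • ξ → ‖μ - u‖ ≤ ρ → (star ξ ⬝ᵥ J *ᵥ ξ).re ≤ 0 → ξ = 0} :=
  fun h => hξ (h ξ μ hx hμ hiso.le)

/-- **A `U(J)`-element's eigenvector with a non-unimodular eigenvalue is `J`-ISOTROPIC**: `J(ξ,ξ) = J(tξ,tξ) = |λ|² J(ξ,ξ)`. [cite: Shelstad1979, §4 p. 22]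
[cite: Rogawski1990, §8.2 p. 119] -/
theorem star_dotProduct_mulVec_eq_zero_of_norm_ne_one {J : Matrix (Fin n) (Fin n) ℂ} {t : GL (Fin n) ℂ} (ht : t ∈ unitaryGroupOfForm (starRingEnd ℂ) J)
    {ξ : Fin n → ℂ} {μ : ℂ} (hx : (t : Matrix (Fin n) (Fin n) ℂ) *ᵥ ξ = μ • ξ) (hμ : ‖μ‖ ≠ 1) : star ξ ⬝ᵥ J *ᵥ ξ = 0 := by
  have h := star_mulVec_dotProduct_mulVec_of_mem ht ξ
  rw [hx, star_smul, mulVec_smul, smul_dotProduct, dotProduct_smul, smul_smul, Complex.star_def, Complex.conj_mul', smul_eq_mul] at h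
  -- `‖μ‖² · q = q` with `‖μ‖² ≠ 1`
  have hne : ((‖μ‖ : ℂ) ^ 2) ≠ 1 := by
    intro h1
    have h2 : (‖μ‖ ^ 2 : ℝ) = 1 := by exact_mod_cast h1
    exact hμ (by nlinarith [norm_nonneg μ, h2, sq_nonneg (‖μ‖ - 1)])
  have : ((‖μ‖ : ℂ) ^ 2 - 1) * (star ξ ⬝ᵥ J *ᵥ ξ) = 0 := by rw [sub_mul, one_mul, h, sub_self]
  rcases mul_eq_zero.1 this with h0 | h0
  · exact absurd (sub_eq_zero.1 h0) hne
  · exact h0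

/-- `U(J) ≤ U(c • J)` (a scalar multiple of the form has the same isometries). [cite: Rogawski1990, §3.6 p. 31] -/
theorem mem_unitaryGroupOfForm_smul {J : Matrix (Fin n) (Fin n) ℂ} {g : GL (Fin n) ℂ} (hg : g ∈ unitaryGroupOfForm (starRingEnd ℂ) J) (c : ℂ) :
    g ∈ unitaryGroupOfForm (starRingEnd ℂ) (c • J) := by
  rw [mem_unitaryGroupOfForm_iff] at hg ⊢
  rw [Matrix.mul_smul, Matrix.smul_mul, hg]

end UnitaryGroup

end Literature.NumberTheory.Automorphic

end
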